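import Summits.Ventures.AbcSig.Conjectures.KrausTableRefines

/-!
# Venture AbcSig — a PROVED symmetry reduction of the computable Kraus tables (`krausTable ⊆ krausTableR`)

HONEST FRAMING. Infrastructure file of the computation cell `pub-abcsig` (p-lean g20); no Diophantine statement, no new hypothesis, no claim
on ABC or any summit. `krausTable μ A B C n q` (`Recipes/KrausTable.lean`) enumerates ALL pairs `(u, c)`, `u ∈ U := nthPowerResidues q n`,
`c ∈ 𝔽_q`, keeps those with `aⁿ := (Cc² − Bu)/A ∈ U`, and lists the traces `a_q(E_μ(u, c))` computed as character sums (`traceNaive`, `q`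
Legendre symbols each). At an auxiliary prime `q ≡ 1 (mod n)` this is `≈ |U|²·q` Legendre symbols in the KERNEL whenever a certificate is
checked against the table (`≈ 4.2·10⁵` at `q = 599`, `≈ 2.0·10⁶` at `q = 1013` for `n = 23`), which is what kept the two `q = 599` class
certificates of `Conjectures/LevelRaising32L2Instance313.lean` out of the tree (hypothesis `h599` there) and the four `q = 1013` classes of
NEGATIVE-21 out of the kernel altogether.

THIS FILE proves that the enumeration is redundant by the factor `2·|U⁴|` — precisely: for `l ∈ U` the kept pair `(u, c)` and the pair
`(u·l⁴, ±c·l²)` give 𝔽_q-ISOMORPHIC curves up to the quadratic twist by `−1` (`E_μ(u, c) : Y² = X³ + a₂X² + a₄X` has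
`(a₂, a₄) ∝ (c, u)` in every model, and `X ↦ l²X` rescales `(a₂, a₄) ↦ (l²a₂, l⁴a₄)`), so their character sums agree up to the sign
`χ_q(−1)`:

* `traceNaive_scale`: `Σ_x χ(x³ + v a x² + v² b x) = χ(v) · Σ_x χ(x³ + a x² + b x)` for a unit `v` of `𝔽_q` (reindex `x = v y`,
  `χ` multiplicative, `χ(v)³ = χ(v)`), stated for `traceNaive` through the tree's own bridge `legendreNaive_eq_quadraticChar`
  (`Conjectures/KrausTableSemantics.lean`);
* `kept_scale`: the kept condition (`aⁿ ≠ 0`, `aⁿ ∈ U`) is transported along `(u, c) ↦ (v²u, v c)` when `v²` is an `n`-th power of a unit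
  (`U` is a subgroup of `𝔽_q^×`; characterization `mem_nthPowerResidues_iff`);
* **`krausTable_subset_reduced`**: for `q` an odd prime and a representative list `R` with
  `coverCheck q n R = true` (decidable: every `u ∈ U` has `u·l⁴ ≡ r` for some `l ∈ U`, `r ∈ R`), EVERY entry of `krausTable μ A B C n q` is
  an entry of the REDUCED table `krausTableR μ A B C n q R`, which enumerates only `u ∈ R` and `c ∈ {0, …, (q−1)/2}` and inserts each kept
  trace `t` together with `χ_q(−1)·t`. (`|R| = |U/U⁴|`: 2 at `q = 599`, 4 at `q = 1013` for `n = 23`; kernel cost `≈ |R|·|U|·q/2` symbols: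
  measured 7 s at 599 and 36 s at 1013 on the farm, against 157 s resp. beyond any sane budget for the full tables.)
* `OrbitData.Eliminated.anti`: `o.Eliminated A n` is ANTITONE in the allowed-trace function `A` (a realisation with traces in the smaller sets
  is one with traces in the larger sets), so a sieve certificate checked against the reduced table at one auxiliary prime (and the class table
  elsewhere) eliminates the datum against the class table itself.

No statement of the cell changes; the consumers are `Conjectures/LevelRaising32L2Instance313H599.lean` (discharge of `h599`) and
`Conjectures/LevelRaising32L2Instance313R8.lean` (the four `q = 1013` classes of the typed residual `LR32Residual313`: twelve → eight). Everything here is PROVED (no `sorry`, no new axiom, no cited package); the two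
definitions are plain computable list functions in the style of `Recipes/KrausTable.lean`.

References: A. Kraus, Canad. J. Math. 49 (1997) 1139–1161; [BS04] M. A. Bennett, C. M. Skinner, Canad. J. Math. 56 (2004) 23–54, Lemma 4.2,
Prop. 4.3 (the tables); the isomorphism / twist invariance of `a_q` is textbook ([Sil09] J. H. Silverman, *The Arithmetic of Elliptic
Curves*, III §1, X §5 — here only the elementary character-sum identity is used and proved). Cell records: HOME/plean/g20/README-g20.md.
-/

namespace Summit.Ventures.AbcSig.Conjectures

open Summit.Ventures.AbcSig

/-! ## The reduced table and its cover condition (computable, kernel-evaluated like `krausTable`) -/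

/-- The residue `aⁿ := (Cc² − Bu)·A⁻¹ mod q` exactly as `krausTable` computes it (natural-number arithmetic). -/
def keptResidue (q A B C u c : ℕ) : ℕ := (C * c * c % q + q - B * u % q) % q * invModP q A % q

/-- **The symmetry-reduced Kraus table.** Same enumeration as `krausTable μ A B C n q` but `u` ranges over the representative list `R`
only and `c` over `{0, …, (q−1)/2}` (`List.range ((q+1)/2)`); every kept trace `t` is inserted together with `χ_q(−1)·t`
(`legendreNaive q (q − 1) * t`). Sorted and duplicate-free like `krausTable` (only membership is ever used). -/
def krausTableR (μ : FreyModel) (A B C n q : ℕ) (R : List ℕ) : List ℤ :=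
  let U := nthPowerResidues q n
  let Ainv := invModP q A
  let s : ℤ := legendreNaive q (q - 1)
  let traces : List ℤ := R.flatMap fun u => (List.range ((q + 1) / 2)).filterMap fun c =>
    let an := (C * c * c % q + q - B * u % q) % q * Ainv % q
    if an ≠ 0 ∧ an ∈ U then
      let p := μ.coeffs q B C u c
      some (traceNaive q p.1 p.2)
    else none
  traces.foldl (fun acc t => insertSorted (s * t) (insertSorted t acc)) [-((q : ℤ) + 1), (q : ℤ) + 1]

/-- **Cover condition** for a representative list `R` at `(q, n)`: every `u ∈ U = nthPowerResidues q n` satisfies `u·l⁴ ≡ r (mod q)` for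
some `l ∈ U` and some `r ∈ R` (i.e. `R` meets every coset of the fourth powers `U⁴` in `U`). Decidable; checked by `decide` at each use. -/
def coverCheck (q n : ℕ) (R : List ℕ) : Bool :=
  (nthPowerResidues q n).all fun u => R.any fun r => (nthPowerResidues q n).any fun l => u * l ^ 4 % q == r

/-! ## Membership bookkeeping -/

/-- What an element of `krausTable μ A B C n q` is (the tree's `mem_krausTable`, keeping also the condition `aⁿ ∈ U`). -/
theorem mem_krausTable' {μ : FreyModel} {A B C n q : ℕ} {t : ℤ} (ht : t ∈ krausTable μ A B C n q) :
    t = -((q : ℤ) + 1) ∨ t = (q : ℤ) + 1 ∨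
      ∃ u ∈ nthPowerResidues q n, ∃ c < q, keptResidue q A B C u c ≠ 0 ∧ keptResidue q A B C u c ∈ nthPowerResidues q n ∧
        t = traceNaive q (μ.coeffs q B C u c).1 (μ.coeffs q B C u c).2 := by
  unfold krausTable at ht
  simp only at ht
  rw [mem_foldl_insertSorted] at ht
  rcases ht with ht | ht
  · right; right
    simp only [List.mem_flatMap, List.mem_filterMap, List.mem_range] at ht
    obtain ⟨u, hu, c, hc, h⟩ := ht
    split_ifs at h with hcond
    · refine ⟨u, hu, c, hc, hcond.1, hcond.2, ?_⟩
      simpa using (Option.some.inj h).symm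
  · simp only [List.mem_cons, List.not_mem_nil, or_false] at ht
    rcases ht with h | h
    · exact Or.inl h
    · exact Or.inr (Or.inl h)

/-- Membership in the double `insertSorted` fold of `krausTableR`. -/
theorem mem_foldl_insertSorted₂ {x : ℤ} (s : ℤ) (l acc : List ℤ) :
    x ∈ l.foldl (fun acc t => insertSorted (s * t) (insertSorted t acc)) acc ↔ (∃ t ∈ l, x = t ∨ x = s * t) ∨ x ∈ acc := by
  induction l generalizing acc with
  | nil => simp
  | cons t rest ih =>
    rw [List.foldl_cons, ih, mem_insertSorted, mem_insertSorted]
    constructor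
    · rintro (⟨t', ht', hx⟩ | hx | hx | hx)
      · exact Or.inl ⟨t', List.mem_cons_of_mem t ht', hx⟩
      · exact Or.inl ⟨t, List.mem_cons_self, Or.inr hx⟩
      · exact Or.inl ⟨t, List.mem_cons_self, Or.inl hx⟩
      · exact Or.inr hx
    · rintro (⟨t', ht', hx⟩ | hx)
      · rcases List.mem_cons.mp ht' with rfl | ht'
        · rcases hx with hx | hx
          · exact Or.inr (Or.inr (Or.inl hx))
          · exact Or.inr (Or.inl hx)
        · exact Or.inl ⟨t', ht', hx⟩
      · exact Or.inr (Or.inr (Or.inr hx))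

/-- How to be an element of `krausTableR μ A B C n q R`: `±(q + 1)`, or `t` / `χ_q(−1)·t` for the trace `t` of a kept pair `(u, c)`
with `u ∈ R`, `c ≤ (q − 1)/2`. -/
theorem mem_krausTableR_of {μ : FreyModel} {A B C n q : ℕ} {R : List ℕ} {x : ℤ}
    (h : x = -((q : ℤ) + 1) ∨ x = (q : ℤ) + 1 ∨
      ∃ u ∈ R, ∃ c < (q + 1) / 2, keptResidue q A B C u c ≠ 0 ∧ keptResidue q A B C u c ∈ nthPowerResidues q n ∧
        (x = traceNaive q (μ.coeffs q B C u c).1 (μ.coeffs q B C u c).2 ∨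
          x = legendreNaive q (q - 1) * traceNaive q (μ.coeffs q B C u c).1 (μ.coeffs q B C u c).2)) :
    x ∈ krausTableR μ A B C n q R := by
  unfold krausTableR
  simp only
  rw [mem_foldl_insertSorted₂]
  rcases h with h | h | ⟨u, hu, c, hc, hne, hmem, hx⟩
  · exact Or.inr (by simp [h])
  · exact Or.inr (by simp [h])
  · refine Or.inl ⟨traceNaive q (μ.coeffs q B C u c).1 (μ.coeffs q B C u c).2, ?_, hx⟩
    simp only [List.mem_flatMap, List.mem_filterMap, List.mem_range]
    refine ⟨u, hu, c, hc, ?_⟩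
    rw [if_pos ⟨hne, hmem⟩]

/-- **Splitting the reduced table by representative.** An entry of `krausTableR … R` is `±(q + 1)` or an entry of the single-representative
table `krausTableR … [r]` for some `r ∈ R` — so a consumer may let the kernel evaluate one representative per declaration. -/
theorem mem_krausTableR_split {μ : FreyModel} {A B C n q : ℕ} {R : List ℕ} {x : ℤ} (hx : x ∈ krausTableR μ A B C n q R) :
    x = -((q : ℤ) + 1) ∨ x = (q : ℤ) + 1 ∨ ∃ r ∈ R, x ∈ krausTableR μ A B C n q [r] := by
  unfold krausTableR at hx ⊢
  simp only at hx ⊢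
  rw [mem_foldl_insertSorted₂] at hx
  rcases hx with ⟨t, ht, hxt⟩ | hx
  · right; right
    rw [List.mem_flatMap] at ht
    obtain ⟨r, hr, htr⟩ := ht
    refine ⟨r, hr, ?_⟩
    rw [mem_foldl_insertSorted₂]
    refine Or.inl ⟨t, ?_, hxt⟩
    rw [List.flatMap_cons, List.flatMap_nil, List.append_nil]
    exact htr
  · simp only [List.mem_cons, List.not_mem_nil, or_false] at hx
    rcases hx with h | h
    · exact Or.inl h
    · exact Or.inr (Or.inl h)

/-! ## Arithmetic of the kept condition in `ZMod q` -/

/-- The generator's residue read in `ZMod q`: `aⁿ = (Cc² − Bu)·A⁻¹`. -/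
theorem cast_keptResidue {q : ℕ} [NeZero q] (A B C u c : ℕ) :
    ((keptResidue q A B C u c : ℕ) : ZMod q) = ((C : ZMod q) * c * c - (B : ZMod q) * u) * ((invModP q A : ℕ) : ZMod q) := by
  unfold keptResidue
  rw [ZMod.natCast_mod, Nat.cast_mul, cast_sub_residue]

/-- The generator's residue is a residue: `< q`. -/
theorem keptResidue_lt {q : ℕ} (hq : 0 < q) (A B C u c : ℕ) : keptResidue q A B C u c < q := Nat.mod_lt _ hq

/-- A natural number `< q` is `0` iff it is `0` in `ZMod q`. -/
theorem natCast_zmod_eq_zero_iff_of_lt {q m : ℕ} (hm : m < q) : (m : ZMod q) = 0 ↔ m = 0 := by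
  rw [ZMod.natCast_eq_zero_iff]
  exact ⟨fun h => Nat.eq_zero_of_dvd_of_lt h hm, fun h => by simp [h]⟩

/-- **Characterization of the generator's `n`-th power residues** (`q` prime): `v ∈ nthPowerResidues q n` iff `v < q` and `v` is, in
`ZMod q`, the `n`-th power of a unit. -/
theorem mem_nthPowerResidues_iff {q n : ℕ} (hq : q.Prime) {v : ℕ} :
    v ∈ nthPowerResidues q n ↔ v < q ∧ ∃ x : ZMod q, x ≠ 0 ∧ x ^ n = (v : ZMod q) := by
  haveI : Fact q.Prime := ⟨hq⟩
  have key : ∀ {a b : ℕ}, a < q → b < q → (a : ZMod q) = (b : ZMod q) → a = b := fun ha hb h => by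
    have := (ZMod.natCast_eq_natCast_iff' _ _ q).mp h
    rwa [Nat.mod_eq_of_lt ha, Nat.mod_eq_of_lt hb] at this
  unfold nthPowerResidues
  rw [List.mem_dedup, List.mem_map]
  constructor
  · rintro ⟨x, hx, rfl⟩
    rw [List.mem_filter, List.mem_range] at hx
    obtain ⟨hxq, hx0⟩ := hx
    have hx0' : x ≠ 0 := by simpa using hx0
    refine ⟨Nat.mod_lt _ hq.pos, (x : ZMod q), ?_, ?_⟩
    · rw [Ne, natCast_zmod_eq_zero_iff_of_lt hxq]; exact hx0'
    · rw [ZMod.natCast_mod, Nat.cast_pow]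
  · rintro ⟨hv, x, hx0, hx⟩
    refine ⟨x.val, ?_, ?_⟩
    · rw [List.mem_filter, List.mem_range]
      refine ⟨ZMod.val_lt x, ?_⟩
      have : x.val ≠ 0 := fun h => hx0 ((ZMod.val_eq_zero x).mp h)
      simpa using this
    · apply key (Nat.mod_lt _ hq.pos) hv
      rw [ZMod.natCast_mod, Nat.cast_pow, ZMod.natCast_zmod_val, hx]

/-! ## The character sum: scaling and twisting -/

/-- `Σ_{x ∈ range q} g(x) = Σ_{y : ZMod q} g(y)` (`q ≠ 0`). -/
theorem sum_range_natCast_zmod {q : ℕ} [NeZero q] (g : ZMod q → ℤ) :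
    ∑ x ∈ Finset.range q, g (x : ZMod q) = ∑ y : ZMod q, g y := by
  refine Finset.sum_nbij' (fun x : ℕ => (x : ZMod q)) (fun y : ZMod q => y.val) (fun _ _ => Finset.mem_univ _)
    (fun y _ => Finset.mem_range.mpr (ZMod.val_lt y)) (fun x hx => ?_) (fun y _ => ZMod.natCast_zmod_val y) (fun _ _ => rfl)
  exact ZMod.val_cast_of_lt (Finset.mem_range.mp hx)

/-- `Σ_{x ∈ range q} f x = ((List.range q).map f).sum`. -/
theorem sum_range_eq_map_sum (q : ℕ) (f : ℕ → ℤ) : ∑ x ∈ Finset.range q, f x = ((List.range q).map f).sum := by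
  rw [Finset.sum_eq_multiset_sum, Finset.range_val, ← Multiset.coe_range, Multiset.map_coe, Multiset.sum_coe]

/-- **The generator's trace as a character sum over `ZMod q`**: `traceNaive q a₂ a₄ = −Σ_{y} χ_q(y³ + a₂y² + a₄y)` (`q` an odd prime). -/
theorem traceNaive_eq_neg_sum {q : ℕ} [Fact q.Prime] (hq2 : q ≠ 2) (a₂ a₄ : ℕ) :
    traceNaive q a₂ a₄ = -∑ y : ZMod q, quadraticChar (ZMod q) (y ^ 3 + (a₂ : ZMod q) * y ^ 2 + (a₄ : ZMod q) * y) := by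
  unfold traceNaive
  rw [← sum_range_eq_map_sum, ← sum_range_natCast_zmod]
  congr 1
  refine Finset.sum_congr rfl fun x _ => ?_
  rw [legendreNaive_eq_quadraticChar hq2]
  push_cast
  rfl

/-- **Scaling / twisting of the character sum**: for a unit `v`, `Σ_y χ(y³ + (v a) y² + (v² b) y) = χ(v) · Σ_y χ(y³ + a y² + b y)`
(substitute `y = v z`; `χ(v³) = χ(v)`). With `v = l²` this is the isomorphism `X ↦ l²X`; with `v = −1` the quadratic twist by `−1`. -/
theorem sum_quadraticChar_cubic_scale {q : ℕ} [Fact q.Prime] (a b v : ZMod q) (hv : v ≠ 0) :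
    ∑ y : ZMod q, quadraticChar (ZMod q) (y ^ 3 + v * a * y ^ 2 + v ^ 2 * b * y) =
      quadraticChar (ZMod q) v * ∑ y : ZMod q, quadraticChar (ZMod q) (y ^ 3 + a * y ^ 2 + b * y) := by
  rw [Finset.mul_sum, ← (mulLeft_bijective₀ v hv).sum_comp
    (fun y => quadraticChar (ZMod q) (y ^ 3 + v * a * y ^ 2 + v ^ 2 * b * y))]
  refine Finset.sum_congr rfl fun z _ => ?_
  have h3 : (v * z) ^ 3 + v * a * (v * z) ^ 2 + v ^ 2 * b * (v * z) = v ^ 3 * (z ^ 3 + a * z ^ 2 + b * z) := by ring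
  simp only [h3, map_mul, map_pow]
  rcases quadraticChar_dichotomy hv with h | h <;> simp [h]

/-- **`traceNaive` under scaling**: if `a₂' ≡ v·a₂` and `a₄' ≡ v²·a₄` for a unit `v` of `𝔽_q` then
`traceNaive q a₂' a₄' = χ_q(v) · traceNaive q a₂ a₄` (`q` an odd prime). -/
theorem traceNaive_scale {q : ℕ} [Fact q.Prime] (hq2 : q ≠ 2) {a₂ a₄ a₂' a₄' : ℕ} {v : ZMod q} (hv : v ≠ 0)
    (h₂ : (a₂' : ZMod q) = v * a₂) (h₄ : (a₄' : ZMod q) = v ^ 2 * a₄) :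
    traceNaive q a₂' a₄' = quadraticChar (ZMod q) v * traceNaive q a₂ a₄ := by
  rw [traceNaive_eq_neg_sum hq2, traceNaive_eq_neg_sum hq2, h₂, h₄, sum_quadraticChar_cubic_scale _ _ _ hv, mul_neg]

/-- `χ_q(−1)` as the generator computes it: `legendreNaive q (q − 1)`. -/
theorem legendreNaive_pred_eq {q : ℕ} [Fact q.Prime] (hq2 : q ≠ 2) :
    legendreNaive q (q - 1) = quadraticChar (ZMod q) (-1) := by
  rw [legendreNaive_eq_quadraticChar hq2, Nat.cast_sub (Fact.out : q.Prime).one_le, ZMod.natCast_self, Nat.cast_one, zero_sub]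

/-! ## The coefficients of the three models scale like `(a₂, a₄) ∝ (c, u)` -/

/-- In each model the coefficients of the pair `(v²u, v c)` are `(v a₂, v² a₄)` for the coefficients `(a₂, a₄)` of `(u, c)`. -/
theorem coeffs_scale (μ : FreyModel) {q : ℕ} [NeZero q] {B C u c r c' : ℕ} {v : ZMod q}
    (hc : (c' : ZMod q) = v * c) (hr : (r : ZMod q) = v ^ 2 * u) :
    (((μ.coeffs q B C r c').1 : ℕ) : ZMod q) = v * (((μ.coeffs q B C u c).1 : ℕ) : ZMod q) ∧
      (((μ.coeffs q B C r c').2 : ℕ) : ZMod q) = v ^ 2 * (((μ.coeffs q B C u c).2 : ℕ) : ZMod q) := by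
  cases μ <;> simp only [FreyModel.coeffs, ZMod.natCast_mod, Nat.cast_mul, Nat.cast_ofNat, hc, hr] <;> constructor <;> ring

/-! ## Transport of a kept pair along the symmetry -/

/-- **Kept pairs transport.** If `(u, c)` is kept (`aⁿ ∈ U`; then `aⁿ ≠ 0` automatically, `q` prime) and `c' ≡ v c`, `r ≡ v² u` with
`v²` the `n`-th power of a unit, then `(r, c')` is kept (`aⁿ ≠ 0` and `aⁿ ∈ U`) and its trace is `χ_q(v)` times the trace of `(u, c)`. -/
theorem kept_scale (μ : FreyModel) {q : ℕ} [Fact q.Prime] (hq2 : q ≠ 2) {A B C n u c r c' : ℕ} {v : ZMod q} (hv : v ≠ 0)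
    (hvn : ∃ y : ZMod q, y ≠ 0 ∧ y ^ n = v ^ 2) (hc : (c' : ZMod q) = v * c) (hr : (r : ZMod q) = v ^ 2 * u)
    (hmem : keptResidue q A B C u c ∈ nthPowerResidues q n) :
    keptResidue q A B C r c' ≠ 0 ∧ keptResidue q A B C r c' ∈ nthPowerResidues q n ∧
      traceNaive q (μ.coeffs q B C r c').1 (μ.coeffs q B C r c').2 =
        quadraticChar (ZMod q) v * traceNaive q (μ.coeffs q B C u c).1 (μ.coeffs q B C u c).2 := by
  have hq : q.Prime := Fact.out
  haveI : NeZero q := ⟨hq.ne_zero⟩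
  obtain ⟨y, hy0, hy⟩ := hvn
  obtain ⟨-, x₀, hx₀, hx⟩ := (mem_nthPowerResidues_iff hq).mp hmem
  -- the new residue is `v² · aⁿ = (y x₀)ⁿ`
  have hcast : ((keptResidue q A B C r c' : ℕ) : ZMod q) = (y * x₀) ^ n := by
    rw [cast_keptResidue, hc, hr, mul_pow, hy, hx, cast_keptResidue]
    ring
  have hne' : ((keptResidue q A B C r c' : ℕ) : ZMod q) ≠ 0 := by
    rw [hcast]; exact pow_ne_zero _ (mul_ne_zero hy0 hx₀)
  refine ⟨fun h => hne' (by rw [h, Nat.cast_zero]), ?_, ?_⟩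
  · exact (mem_nthPowerResidues_iff hq).mpr ⟨keptResidue_lt hq.pos _ _ _ _ _, y * x₀, mul_ne_zero hy0 hx₀, hcast.symm⟩
  · obtain ⟨h₂, h₄⟩ := coeffs_scale μ (B := B) (C := C) hc hr
    exact traceNaive_scale hq2 hv h₂ h₄

/-! ## The subset theorem -/

/-- **`krausTable ⊆ krausTableR`.** For an odd prime `q` and a representative list `R` passing `coverCheck q n R`, every entry of the
class table `krausTable μ A B C n q` is an entry of the reduced table `krausTableR μ A B C n q R` (any `μ`, `A`, `B`, `C`). -/
theorem krausTable_subset_reduced (μ : FreyModel) {A B C n q : ℕ} (hq : q.Prime) (hq2 : q ≠ 2) {R : List ℕ}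
    (hR : coverCheck q n R = true) : ∀ t ∈ krausTable μ A B C n q, t ∈ krausTableR μ A B C n q R := by
  haveI : Fact q.Prime := ⟨hq⟩
  haveI : NeZero q := ⟨hq.ne_zero⟩
  have hodd : q % 2 = 1 := Nat.odd_iff.mp (hq.odd_of_ne_two hq2)
  intro t ht
  apply mem_krausTableR_of
  rcases mem_krausTable' ht with h | h | ⟨u, hu, c, -, -, hmem, rfl⟩
  · exact Or.inl h
  · exact Or.inr (Or.inl h)
  right; right
  -- the cover: `u · l⁴ ≡ r` with `l ∈ U`, `r ∈ R`
  obtain ⟨r, hr, l, hl, hrl⟩ : ∃ r ∈ R, ∃ l ∈ nthPowerResidues q n, u * l ^ 4 % q = r := by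
    have := List.all_eq_true.mp hR u hu
    simp only [List.any_eq_true, beq_iff_eq] at this
    exact this
  obtain ⟨-, y₀, hy₀, hy₀l⟩ := (mem_nthPowerResidues_iff hq).mp hl
  have hl0 : (l : ZMod q) ≠ 0 := nthPowerResidues_ne_zero hq hl
  have hru : (r : ZMod q) = ((l : ZMod q) ^ 2) ^ 2 * u := by
    rw [← hrl, ZMod.natCast_mod]; push_cast; ring
  have hvn : ∃ y : ZMod q, y ≠ 0 ∧ y ^ n = ((l : ZMod q) ^ 2) ^ 2 :=
    ⟨y₀ ^ 4, pow_ne_zero _ hy₀, by rw [← pow_mul, mul_comm, pow_mul, hy₀l]; ring⟩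
  -- the rescaled `c`
  set c₁ : ℕ := c * l ^ 2 % q with hc₁def
  have hc₁q : c₁ < q := Nat.mod_lt _ hq.pos
  have hc₁ : (c₁ : ZMod q) = (l : ZMod q) ^ 2 * c := by
    rw [hc₁def, ZMod.natCast_mod]; push_cast; ring
  by_cases hlt : c₁ < (q + 1) / 2
  · -- no sign: `v = l²`, `χ(v) = 1`
    have hv : ((l : ZMod q) ^ 2) ≠ 0 := pow_ne_zero _ hl0
    obtain ⟨hne', hmem', htr⟩ := kept_scale μ hq2 (A := A) (B := B) (C := C) hv hvn hc₁ hru hmem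
    refine ⟨r, hr, c₁, hlt, hne', hmem', Or.inl ?_⟩
    rw [htr, quadraticChar_sq_one' hl0, one_mul]
  · -- sign: `c₂ = q − c₁`, `v = −l²`, `χ(v) = χ(−1)`
    have hle : c₁ ≤ q := hc₁q.le
    have hv : (-((l : ZMod q) ^ 2)) ≠ 0 := neg_ne_zero.mpr (pow_ne_zero _ hl0)
    have hc₂ : ((q - c₁ : ℕ) : ZMod q) = -((l : ZMod q) ^ 2) * c := by
      rw [Nat.cast_sub hle, ZMod.natCast_self, zero_sub, hc₁, neg_mul]
    have hru' : (r : ZMod q) = (-((l : ZMod q) ^ 2)) ^ 2 * u := by rw [neg_sq]; exact hru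
    have hvn' : ∃ y : ZMod q, y ≠ 0 ∧ y ^ n = (-((l : ZMod q) ^ 2)) ^ 2 := by rw [neg_sq]; exact hvn
    obtain ⟨hne', hmem', htr⟩ := kept_scale μ hq2 (A := A) (B := B) (C := C) hv hvn' hc₂ hru' hmem
    refine ⟨r, hr, q - c₁, by omega, hne', hmem', Or.inr ?_⟩
    have hχv : quadraticChar (ZMod q) (-((l : ZMod q) ^ 2)) = quadraticChar (ZMod q) (-1) := by
      rw [← neg_one_mul, map_mul, quadraticChar_sq_one' hl0, mul_one]
    rw [htr, hχv, legendreNaive_pred_eq hq2, ← mul_assoc, ← sq, quadraticChar_sq_one (neg_ne_zero.mpr one_ne_zero), one_mul]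

/-! ## `Eliminated` is antitone in the allowed-trace function -/

/-- **Antitonicity of elimination.** If `A ℓ ⊆ A' ℓ` at every listed prime of the datum, a datum eliminated against `A'` is eliminated
against `A` (a realisation with traces in `A` is one with traces in `A'`). -/
theorem _root_.Summit.Ventures.AbcSig.OrbitData.Eliminated.anti {o : OrbitData} {A A' : ℕ → List ℤ} {n : ℕ}
    (h : o.Eliminated A' n) (hAA' : ∀ e ∈ o.coeffs, ∀ t ∈ A e.ell, t ∈ A' e.ell) : o.Eliminated A n := by
  intro k _ _ φ hφ
  obtain ⟨hF, hc⟩ := hφ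
  refine h k φ ⟨hF, fun e he hne => ?_⟩
  obtain ⟨t, ht, hφt⟩ := hc e he hne
  exact ⟨t, hAA' e he t ht, hφt⟩

/-! ## Kernel sanity (small): at `(q, n) = (47, 23)`, `U = {1, 46}` and `U⁴ = {1}`, so the representatives are `R = [1, 46]` (and `[1]`
does NOT cover); the reduced table of the class `(E₁, 1, 313⁴)` with `R = [1, 46]` contains the full one. -/

example : coverCheck 47 23 [1, 46] = true ∧ coverCheck 47 23 [1] = false := by decide +kernel

example : ∀ t ∈ krausTable .E1 1 (313 ^ 4) 1 23 47, t ∈ krausTableR .E1 1 (313 ^ 4) 1 23 47 [1, 46] := by decide +kernel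

end Summit.Ventures.AbcSig.Conjectures
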